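import Summits.Schanuel.Schanuel.Theorems.ZilberEacRealHyperplaneFast
import Literature.ModelTheory.Zilber.EACDensityQuestion
import HarnessLib

/-!
# The mixed fast/slow regime over real hyperplanes: relative smallness around CONTROLLED centres

Zilber's Exponential-Algebraic Closedness, case ladder (host summit Schanuel, cell `pub-schanuel`,
seat 2, gen 12).  THEOREM R⁺⁺ (`ZilberEacRealHyperplaneFast.exists_expPoint_realHyperplane_mixed`,
gen 8) works in the transformed coordinates `z` (`x = fastBack r c e z`, `e = 1 + deg F₀`,
`Â = fastData r c A F`) and proves that the perturbations

  `P₀(z) = c₀⁻¹ (e^{x₀(z)} - u F̃₀(u))`,  `Pⱼ(z) = u Fⱼ(u)` (`j ≥ 1`),  `u = e^{z₀/e}`,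

are relatively small (`‖Pⱼ‖ ≤ θ m^{d̂ⱼ}` for every `θ > 0`, large `m`) on the unit polydiscs around
the PRINCIPAL lattice centres, using only the two-sided control `|Re zⱼ - d̂ⱼ log m| ≤ C_b` there.
This file isolates that estimate for ARBITRARY centres satisfying the same control — the input
needed for the LABELLED version of THEOREM R⁺⁺ (`ZilberEacHyperplaneMixedExistence`), whose
labelled centres use a continuous branch of `log Âⱼ(2πi m q)` shifted by `2πi p`.

* `mixed_perturbation_small` — the smallness from the control, under R⁺⁺'s exponent conditions
  (i) `ν = (d̂₀/e - Σ_{i≥1} rᵢ d̂ᵢ)/r₀ < d̂₀`, (ii) `d̂₀(1 + deg Fⱼ) < e d̂ⱼ` (`j ≥ 1`, `Fⱼ ≠ 0`).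

HONEST FRAMING: an estimate (the proof is gen 8's, re-centred); `EC(3,2)` OPEN; NOT Schanuel's
conjecture; EAC ⇏ SC.
-/

noncomputable section

open Complex MvPolynomial Filter Topology Metric
open Literature.NumberTheory.Transcendental Literature.ModelTheory.Zilber

set_option linter.dupNamespace false

namespace Summit.Schanuel.Schanuel.Theorems

section MixedBounds

variable {s : ℕ}

/-- **Relative smallness of the R⁺⁺ perturbations around controlled centres.**  `r₀ ≠ 0`, `F₀ ≠ 0`,
`Â = fastData r c A F`, `d̂ⱼ = deg Âⱼ`, `e = 1 + deg F₀`; centres `cen(m)` with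
`|Re(cen(m)ⱼ + ξⱼ) - d̂ⱼ log m| ≤ C_b` for `‖ξ‖ ≤ 1` (large `m`); exponent conditions (i), (ii) and
`d̂₀ ≥ 1`.  Then for every `j` and `θ > 0`, eventually `‖Pⱼ(cen(m) + ξ)‖ ≤ θ m^{d̂ⱼ}` on `‖ξ‖ < 1`.
(new) [cite: MantovaMasser2023, §1 p.5 (the open case dim π(V) = 2 in ℂ³×ℂˣ³)] -/
theorem mixed_perturbation_small (r : Fin (s + 1) → ℝ) (hr : r 0 ≠ 0) (c : ℂ)
    (A : Fin (s + 1) → MvPolynomial (Fin (s + 1)) ℂ) (F : Fin (s + 1) → Polynomial ℂ) (hF : F 0 ≠ 0)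
    (hd0 : 0 < (fastData r c A F 0).totalDegree)
    (hν : (((fastData r c A F 0).totalDegree : ℝ) / ((F 0).natDegree + 1) -
        ∑ i : Fin s, r i.succ * (fastData r c A F i.succ).totalDegree) / r 0 <
      (fastData r c A F 0).totalDegree)
    (hfast : ∀ i : Fin s, F i.succ ≠ 0 →
      ((fastData r c A F 0).totalDegree : ℝ) * ((F i.succ).natDegree + 1) <
        ((F 0).natDegree + 1) * (fastData r c A F i.succ).totalDegree)
    (cen : ℕ → Fin (s + 1) → ℂ) (Cb : ℝ) (hCb0 : 0 ≤ Cb)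
    (hbox : ∀ᶠ m : ℕ in atTop, ∀ ξ : Fin (s + 1) → ℂ, ‖ξ‖ ≤ 1 →
      ∀ j, |(cen m j + ξ j).re - (fastData r c A F j).totalDegree * Real.log m| ≤ Cb)
    (j : Fin (s + 1)) (θ : ℝ) (hθ : 0 < θ) :
    ∀ᶠ m : ℕ in atTop, ∀ ξ : Fin (s + 1) → ℂ, ‖ξ‖ < 1 →
      ‖(Fin.cons (fun z : Fin (s + 1) → ℂ => ((F 0).leadingCoeff)⁻¹ *
          (exp (fastBack r c ((F 0).natDegree + 1) z 0) -
            exp (z 0 / (((F 0).natDegree + 1 : ℕ) : ℂ)) *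
              (F 0).eraseLead.eval (exp (z 0 / (((F 0).natDegree + 1 : ℕ) : ℂ)))))
        (fun (i : Fin s) (z : Fin (s + 1) → ℂ) => exp (z 0 / (((F 0).natDegree + 1 : ℕ) : ℂ)) *
          (F i.succ).eval (exp (z 0 / (((F 0).natDegree + 1 : ℕ) : ℂ)))) :
        Fin (s + 1) → (Fin (s + 1) → ℂ) → ℂ) j (cen m + ξ)‖ ≤
        θ * (m : ℝ) ^ (fastData r c A F j).totalDegree := by
  classical
  -- ### names
  set e : ℕ := (F 0).natDegree + 1 with he
  have hepos : (0 : ℝ) < e := by positivity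
  have he1 : (1 : ℝ) ≤ e := by rw [he]; exact_mod_cast Nat.succ_le_succ (Nat.zero_le _)
  set Ah : Fin (s + 1) → MvPolynomial (Fin (s + 1)) ℂ := fastData r c A F with hAh
  set d : Fin (s + 1) → ℕ := fun j => (Ah j).totalDegree with hd
  set c₀ : ℂ := (F 0).leadingCoeff with hc₀def
  set Fe : Polynomial ℂ := (F 0).eraseLead with hFe
  set ν : ℝ := (((d 0 : ℝ) / e - ∑ i : Fin s, r i.succ * (d i.succ : ℝ))) / r 0 with hνdef
  have hνlt : ν < d 0 := by
    have : ν = (((d 0 : ℝ)) / ((F 0).natDegree + 1) - ∑ i : Fin s, r i.succ * (d i.succ : ℝ)) / r 0 := by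
      rw [hνdef, he]; push_cast; rfl
    rw [this]; exact hν
  -- ### the perturbations
  set P : Fin (s + 1) → (Fin (s + 1) → ℂ) → ℂ :=
    Fin.cons (fun z => c₀⁻¹ * (exp (fastBack r c e z 0) - exp (z 0 / (e : ℂ)) * Fe.eval (exp (z 0 / (e : ℂ)))))
      (fun i z => exp (z 0 / (e : ℂ)) * (F i.succ).eval (exp (z 0 / (e : ℂ)))) with hP
  have hP0 : ∀ z : Fin (s + 1) → ℂ, P 0 z = c₀⁻¹ * (exp (fastBack r c e z 0) -
      exp (z 0 / (e : ℂ)) * Fe.eval (exp (z 0 / (e : ℂ)))) := fun z => by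
    simp only [hP, Fin.cons_zero]
  have hPs : ∀ (i : Fin s) (z : Fin (s + 1) → ℂ),
      P i.succ z = exp (z 0 / (e : ℂ)) * (F i.succ).eval (exp (z 0 / (e : ℂ))) :=
    fun i z => by simp only [hP, Fin.cons_succ]
  -- ### constants for the bounds
  set C₁ : ℝ := (Cb + (∑ i : Fin s, |r i.succ|) * Cb + ‖c‖) / |r 0| with hC₁
  have hC₁0 : 0 ≤ C₁ := by rw [hC₁]; positivity
  set G : Fin (s + 1) → Polynomial ℂ := Fin.cons Fe (fun i => F i.succ) with hG
  set B : Fin (s + 1) → ℝ := fun j => ∑ i ∈ Finset.range ((G j).natDegree + 1), ‖(G j).coeff i‖ with hB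
  have hB0 : ∀ j, 0 ≤ B j := fun j => Finset.sum_nonneg fun _ _ => norm_nonneg _
  -- ### the bound on the unit polydisc
  have hPbound : ∀ᶠ m : ℕ in atTop, ∀ ξ : Fin (s + 1) → ℂ, ‖ξ‖ ≤ 1 →
      ‖P 0 (cen m + ξ)‖ ≤ ‖c₀⁻¹‖ * (Real.exp C₁ * (m : ℝ) ^ ν +
        (if Fe = 0 then 0 else B 0 * Real.exp Cb ^ (1 + Fe.natDegree) *
          (m : ℝ) ^ (((d 0 : ℝ) / e) * (1 + Fe.natDegree)))) ∧
      ∀ i : Fin s, ‖P i.succ (cen m + ξ)‖ ≤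
        (if F i.succ = 0 then 0 else B i.succ * Real.exp Cb ^ (1 + (F i.succ).natDegree) *
          (m : ℝ) ^ (((d 0 : ℝ) / e) * (1 + (F i.succ).natDegree))) := by
    filter_upwards [hbox, eventually_ge_atTop 1] with m hm hm_one ξ hξ
    have hm1 : (1 : ℝ) ≤ m := by exact_mod_cast hm_one
    have hm0 : (0 : ℝ) < m := by linarith
    have ht := hm ξ hξ
    set z : Fin (s + 1) → ℂ := cen m + ξ with hz
    -- `|u| ≤ e^{Cb} m^{d₀/e}` and `max 1 |u|` likewise
    have hu : ‖exp (z 0 / (e : ℂ))‖ ≤ Real.exp Cb * (m : ℝ) ^ ((d 0 : ℝ) / e) := by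
      rw [Complex.norm_exp]
      have hre : (z 0 / (e : ℂ)).re = (z 0).re / e := by
        rw [show (e : ℂ) = ((e : ℝ) : ℂ) by push_cast; rfl, Complex.div_ofReal_re]
      rw [hre]
      have h0 := (abs_le.1 (ht 0)).2
      calc Real.exp ((z 0).re / e) ≤ Real.exp ((d 0 * Real.log m + Cb) / e) :=
            Real.exp_le_exp.2 (div_le_div_of_nonneg_right (by simp only [hz, Pi.add_apply] at h0 ⊢; linarith) hepos.le)
        _ ≤ Real.exp (Cb + (d 0 / e) * Real.log m) := by
            refine Real.exp_le_exp.2 ?_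
            rw [add_div]
            have : Cb / e ≤ Cb := div_le_self hCb0 he1
            have : (d 0 : ℝ) * Real.log m / e = d 0 / e * Real.log m := by ring
            linarith
        _ = Real.exp Cb * (m : ℝ) ^ ((d 0 : ℝ) / e) := by
            rw [Real.exp_add, Real.rpow_def_of_pos hm0, mul_comm (Real.log m)]
    have hu1 : 1 ≤ Real.exp Cb * (m : ℝ) ^ ((d 0 : ℝ) / e) := by
      have ha1 : (1 : ℝ) ≤ Real.exp Cb := Real.one_le_exp hCb0
      have hb1 : (1 : ℝ) ≤ (m : ℝ) ^ ((d 0 : ℝ) / e) := Real.one_le_rpow hm1 (by positivity)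
      nlinarith
    have hmax : max 1 ‖exp (z 0 / (e : ℂ))‖ ≤ Real.exp Cb * (m : ℝ) ^ ((d 0 : ℝ) / e) := max_le hu1 hu
    -- generic bound for `u G(u)`
    have hGb : ∀ G : Polynomial ℂ, ‖exp (z 0 / (e : ℂ)) * G.eval (exp (z 0 / (e : ℂ)))‖ ≤
        if G = 0 then 0 else (∑ i ∈ Finset.range (G.natDegree + 1), ‖G.coeff i‖) *
          Real.exp Cb ^ (1 + G.natDegree) * (m : ℝ) ^ (((d 0 : ℝ) / e) * (1 + G.natDegree)) := by
      intro G
      split_ifs with hG0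
      · rw [hG0, Polynomial.eval_zero, mul_zero, norm_zero]
      · rw [norm_mul]
        have hBG : 0 ≤ ∑ i ∈ Finset.range (G.natDegree + 1), ‖G.coeff i‖ :=
          Finset.sum_nonneg fun _ _ => norm_nonneg _
        have hGe := (norm_eval_le_sum_mul_pow G (exp (z 0 / (e : ℂ)))).trans
          (mul_le_mul_of_nonneg_left (pow_le_pow_left₀ (zero_le_one.trans (le_max_left _ _)) hmax _) hBG)
        calc ‖exp (z 0 / (e : ℂ))‖ * ‖G.eval (exp (z 0 / (e : ℂ)))‖
            ≤ (Real.exp Cb * (m : ℝ) ^ ((d 0 : ℝ) / e)) *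
                ((∑ i ∈ Finset.range (G.natDegree + 1), ‖G.coeff i‖) *
                  (Real.exp Cb * (m : ℝ) ^ ((d 0 : ℝ) / e)) ^ G.natDegree) :=
              mul_le_mul hu hGe (norm_nonneg _) (by positivity)
          _ = (∑ i ∈ Finset.range (G.natDegree + 1), ‖G.coeff i‖) *
                (Real.exp Cb * (m : ℝ) ^ ((d 0 : ℝ) / e)) ^ (1 + G.natDegree) := by ring
          _ = (∑ i ∈ Finset.range (G.natDegree + 1), ‖G.coeff i‖) * Real.exp Cb ^ (1 + G.natDegree) *
                (m : ℝ) ^ (((d 0 : ℝ) / e) * (1 + G.natDegree)) := by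
              rw [mul_pow, ← Real.rpow_natCast ((m : ℝ) ^ ((d 0 : ℝ) / e)), ← Real.rpow_mul hm0.le]
              push_cast
              ring
    constructor
    · -- `P 0`
      have hx0re : (fastBack r c e z 0).re ≤ ν * Real.log m + C₁ := by
        rw [re_fastBack_zero]
        have ht0 := ht 0
        have hts := fun i : Fin s => ht i.succ
        simp only [hz, Pi.add_apply] at ht0 hts ⊢
        set T : ℝ := ((cen m 0 + ξ 0).re / e - ∑ i : Fin s, r i.succ * (cen m i.succ + ξ i.succ).re - c.re)
          with hT
        have hνr : ν * r 0 = (d 0 : ℝ) / e - ∑ i : Fin s, r i.succ * (d i.succ : ℝ) := by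
          rw [hνdef]; field_simp
        have hsumsplit : ∑ i : Fin s, r i.succ * ((cen m i.succ + ξ i.succ).re - d i.succ * Real.log m) =
            ∑ i : Fin s, r i.succ * (cen m i.succ + ξ i.succ).re -
              (∑ i : Fin s, r i.succ * (d i.succ : ℝ)) * Real.log m := by
          rw [Finset.sum_mul, ← Finset.sum_sub_distrib]
          exact Finset.sum_congr rfl fun i _ => by ring
        have hTν : T = ν * r 0 * Real.log m + (((cen m 0 + ξ 0).re - d 0 * Real.log m) / e -
            ∑ i : Fin s, r i.succ * ((cen m i.succ + ξ i.succ).re - d i.succ * Real.log m) - c.re) := by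
          rw [hT, hsumsplit, hνr]
          field_simp
          ring
        have hErr : |((cen m 0 + ξ 0).re - d 0 * Real.log m) / e -
            ∑ i : Fin s, r i.succ * ((cen m i.succ + ξ i.succ).re - d i.succ * Real.log m) - c.re| ≤
            Cb + (∑ i : Fin s, |r i.succ|) * Cb + ‖c‖ := by
          refine (abs_sub _ _).trans (add_le_add ((abs_sub _ _).trans (add_le_add ?_ ?_)) (Complex.abs_re_le_norm c))
          · rw [abs_div, abs_of_pos hepos]
            exact (div_le_self (abs_nonneg _) he1).trans ht0
          · refine (Finset.abs_sum_le_sum_abs _ _).trans ?_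
            rw [Finset.sum_mul]
            refine Finset.sum_le_sum fun i _ => ?_
            rw [abs_mul]
            exact mul_le_mul_of_nonneg_left (hts i) (abs_nonneg _)
        have hr0 : 0 < |r 0| := abs_pos.2 hr
        have key : T / r 0 ≤ ν * Real.log m + C₁ := by
          rw [hTν, add_div, show ν * r 0 * Real.log m / r 0 = ν * Real.log m by field_simp]
          gcongr ν * Real.log m + ?_
          rw [hC₁, le_div_iff₀ hr0]
          calc _ * |r 0| ≤ |(((cen m 0 + ξ 0).re - d 0 * Real.log m) / e -
                ∑ i : Fin s, r i.succ * ((cen m i.succ + ξ i.succ).re - d i.succ * Real.log m) - c.re) / r 0| * |r 0| :=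
                mul_le_mul_of_nonneg_right (le_abs_self _) hr0.le
            _ = |((cen m 0 + ξ 0).re - d 0 * Real.log m) / e -
                ∑ i : Fin s, r i.succ * ((cen m i.succ + ξ i.succ).re - d i.succ * Real.log m) - c.re| := by
                rw [abs_div, div_mul_cancel₀ _ hr0.ne']
            _ ≤ _ := hErr
        exact key
      rw [hP0, norm_mul]
      refine mul_le_mul_of_nonneg_left ((norm_sub_le _ _).trans (add_le_add ?_ ?_)) (norm_nonneg _)
      · rw [Complex.norm_exp]
        calc Real.exp (fastBack r c e z 0).re ≤ Real.exp (C₁ + ν * Real.log m) :=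
              Real.exp_le_exp.2 (by linarith)
          _ = Real.exp C₁ * (m : ℝ) ^ ν := by rw [Real.exp_add, Real.rpow_def_of_pos hm0, mul_comm (Real.log m)]
      · have h := hGb Fe
        simp only [hB, hG, Fin.cons_zero]
        exact h
    · intro i
      rw [hPs]
      have h := hGb (F i.succ)
      simp only [hB, hG, Fin.cons_succ]
      exact h
  -- ### relative smallness
  have hc0 : c₀ ≠ 0 := Polynomial.leadingCoeff_ne_zero.2 hF
  refine Fin.cases ?_ (fun i => ?_) j
  · -- the fast coordinate
    have hsecond : ∀ᶠ m : ℕ in atTop,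
        ‖c₀⁻¹‖ * (if Fe = 0 then 0 else B 0 * Real.exp Cb ^ (1 + Fe.natDegree) *
          (m : ℝ) ^ (((d 0 : ℝ) / e) * (1 + Fe.natDegree))) ≤ θ / 2 * (m : ℝ) ^ (d 0 : ℝ) := by
      by_cases hFe0 : Fe = 0
      · simp only [hFe0, if_true, mul_zero]
        filter_upwards [eventually_ge_atTop 1] with m hm
        positivity
      · simp only [hFe0, if_false]
        have hμlt : ((d 0 : ℝ) / e) * (1 + Fe.natDegree) < d 0 := by
          have hf1 : 1 ≤ (F 0).natDegree := by
            by_contra h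
            push Not at h
            have h0 : (F 0).natDegree = 0 := by omega
            apply hFe0
            rw [hFe, Polynomial.eq_C_of_natDegree_eq_zero h0, Polynomial.eraseLead_C]
          have hFedeg : Fe.natDegree ≤ (F 0).natDegree - 1 := Polynomial.eraseLead_natDegree_le _
          have hlt : (1 + Fe.natDegree : ℝ) < e := by
            rw [he]
            have : 1 + Fe.natDegree < (F 0).natDegree + 1 := by omega
            exact_mod_cast this
          have hd0' : (0 : ℝ) < d 0 := by exact_mod_cast hd0
          calc (d 0 : ℝ) / e * (1 + Fe.natDegree) < (d 0 : ℝ) / e * e :=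
                mul_lt_mul_of_pos_left hlt (by positivity)
            _ = d 0 := by field_simp
        have h := eventually_const_mul_rpow_le (‖c₀⁻¹‖ * (B 0 * Real.exp Cb ^ (1 + Fe.natDegree))) hμlt
          (half_pos hθ)
        filter_upwards [h] with m hm
        calc ‖c₀⁻¹‖ * (B 0 * Real.exp Cb ^ (1 + Fe.natDegree) * (m : ℝ) ^ ((d 0 : ℝ) / e * (1 + Fe.natDegree)))
            = ‖c₀⁻¹‖ * (B 0 * Real.exp Cb ^ (1 + Fe.natDegree)) * (m : ℝ) ^ ((d 0 : ℝ) / e * (1 + Fe.natDegree)) := by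
              ring
          _ ≤ θ / 2 * (m : ℝ) ^ (d 0 : ℝ) := hm
    filter_upwards [hPbound, eventually_const_mul_rpow_le (‖c₀⁻¹‖ * Real.exp C₁) hνlt (half_pos hθ),
      hsecond] with m hm hk1 hk2 ξ hξ
    have h := (hm ξ hξ.le).1
    rw [show (Ah 0).totalDegree = d 0 from rfl, ← Real.rpow_natCast]
    calc ‖P 0 (cen m + ξ)‖ ≤ ‖c₀⁻¹‖ * (Real.exp C₁ * (m : ℝ) ^ ν +
          (if Fe = 0 then 0 else B 0 * Real.exp Cb ^ (1 + Fe.natDegree) *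
            (m : ℝ) ^ (((d 0 : ℝ) / e) * (1 + Fe.natDegree)))) := h
      _ = ‖c₀⁻¹‖ * Real.exp C₁ * (m : ℝ) ^ ν + ‖c₀⁻¹‖ * (if Fe = 0 then 0 else
            B 0 * Real.exp Cb ^ (1 + Fe.natDegree) * (m : ℝ) ^ (((d 0 : ℝ) / e) * (1 + Fe.natDegree))) := by
          ring
      _ ≤ θ / 2 * (m : ℝ) ^ (d 0 : ℝ) + θ / 2 * (m : ℝ) ^ (d 0 : ℝ) := add_le_add hk1 hk2
      _ = θ * (m : ℝ) ^ ((d 0 : ℕ) : ℝ) := by ring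
  · -- the slow coordinates
    by_cases hFi : F i.succ = 0
    · filter_upwards [hPbound, eventually_ge_atTop 1] with m hm hm1 ξ hξ
      have h := (hm ξ hξ.le).2 i
      simp only [hFi, if_true] at h
      exact h.trans (by positivity)
    · have hμlt : ((d 0 : ℝ) / e) * (1 + (F i.succ).natDegree) < d i.succ := by
        have h := hfast i hFi
        rw [div_mul_eq_mul_div, div_lt_iff₀ hepos]
        calc (d 0 : ℝ) * (1 + (F i.succ).natDegree) = (d 0 : ℝ) * ((F i.succ).natDegree + 1) := by ring
          _ < ((F 0).natDegree + 1) * (d i.succ : ℝ) := h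
          _ = (d i.succ : ℝ) * e := by rw [he]; push_cast; ring
      filter_upwards [hPbound, eventually_const_mul_rpow_le
        (B i.succ * Real.exp Cb ^ (1 + (F i.succ).natDegree)) hμlt hθ] with m hm hk ξ hξ
      have h := (hm ξ hξ.le).2 i
      simp only [hFi, if_false] at h
      rw [show (Ah i.succ).totalDegree = d i.succ from rfl, ← Real.rpow_natCast]
      exact h.trans hk

end MixedBounds

end Summit.Schanuel.Schanuel.Theorems

end
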